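import Mathlib
import Literature.NumberTheory.Transcendental.KZCalculusProofs

/-!
# `OffTetraSectorKernel` (stmt-KontsevichZagierPeriods-10557), line `odd-hyperbolic-ladder`:
# structure of a finite-area rung-1 polygon over a strip free of breakpoints

Stub `stub_stripStructure`. Rung 1 of the hyperbolic scissors ladder consists of the areas of
`ℚ̄`-geodesic polygons of the hyperbolic plane (upper half-plane model, `p : Fin 2 → ℝ`,
`x = p 0`, height `t = p 1 > 0`, area density `1/t²`). A polygon is
`P = {t > 0} ∩ ⋂ᵢ {0 < εᵢ · gᵢ}` where `gᵢ` is a vertical line `aᵢ x − cᵢ` (`flat i = true`) or a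
semicircle centred on the boundary `(x − aᵢ)² + t² − cᵢ` (`flat i = false`; `εᵢ = 1`: outside,
`εᵢ = −1`: inside), of finite area. Over an open `x`-interval `J` on which the signs of the affine
constraints, the signs of the `Gᵢ(x) = cᵢ − (x − aᵢ)²` and their pairwise order are constant, the
polygon is empty, or the region above ONE semicircle (the pointwise-largest "outside" one), or the
region between TWO semicircles; finiteness of the area excludes floors `{0 < t < h(x)}` and full
fibres (`∫₀ dt/t² = ∞`), and forces `J` to be bounded in the two non-empty cases.

References: M. Kontsevich, D. Zagier, *Periods* (2001), §1.2, rule (1).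
-/

noncomputable section

open Set MeasureTheory
open Literature.NumberTheory.Transcendental

namespace Summit.KontsevichZagierPeriods.HyperbolicBloch.OffTetraSectorKernel

/-- `t ↦ 1/t²` is not integrable on `(0, η)` for `η > 0` (`∫₀ t^s dt < ∞ ↔ -1 < s`). [folklore] -/
theorem strip_not_integrableOn_inv_sq {η : ℝ} (hη : 0 < η) :
    ¬ IntegrableOn (fun t : ℝ => 1 / t ^ 2) (Ioo 0 η) := by
  intro h
  have h' : IntegrableOn (fun t : ℝ => t ^ (-2 : ℝ)) (Ioo 0 η) := by
    refine h.congr_fun (fun t ht => ?_) measurableSet_Ioo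
    show 1 / t ^ 2 = t ^ (-2 : ℝ)
    rw [Real.rpow_neg ht.1.le, Real.rpow_two, one_div]
  have := (intervalIntegral.integrableOn_Ioo_rpow_iff hη).1 h'
  norm_num at this

/-- Floors have infinite hyperbolic area: a region of the upper half-plane containing a box
`(u, v) × (0, η)` resting on the boundary does not have finite area `∫ dx dt / t²`
(Fubini on the box: every vertical fibre `∫₀^η dt/t²` diverges). [folklore] -/
theorem strip_not_integrableOn_of_box {u v η : ℝ} (huv : u < v) (hη : 0 < η) {P : Set (Fin 2 → ℝ)}
    (hP : {p : Fin 2 → ℝ | u < p 0 ∧ p 0 < v ∧ 0 < p 1 ∧ p 1 < η} ⊆ P) :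
    ¬ IntegrableOn (fun p : Fin 2 → ℝ => 1 / p 1 ^ 2) P := by
  intro hint
  have hbox := hint.mono_set hP
  set e := (MeasurableEquiv.finTwoArrow : (Fin 2 → ℝ) ≃ᵐ ℝ × ℝ) with he
  have hpre : e ⁻¹' (Ioo u v ×ˢ Ioo 0 η) =
      {p : Fin 2 → ℝ | u < p 0 ∧ p 0 < v ∧ 0 < p 1 ∧ p 1 < η} := by
    ext p
    simp [he, MeasurableEquiv.finTwoArrow, and_assoc]
  have h2 : IntegrableOn (fun q : ℝ × ℝ => 1 / q.2 ^ 2) (Ioo u v ×ˢ Ioo 0 η) := by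
    refine ((volume_preserving_finTwoArrow ℝ).integrableOn_comp_preimage
      e.measurableEmbedding).1 ?_
    rw [hpre]
    exact hbox
  rw [IntegrableOn, Measure.volume_eq_prod, ← Measure.prod_restrict] at h2
  have h3 := h2.prod_right_ae
  have hne : (volume.restrict (Ioo u v) : Measure ℝ) ≠ 0 := by
    rw [Ne, Measure.restrict_eq_zero, Real.volume_Ioo, ENNReal.ofReal_eq_zero, not_le]
    linarith
  haveI : (ae (volume.restrict (Ioo u v) : Measure ℝ)).NeBot := ae_neBot.2 hne
  obtain ⟨x, hx⟩ := h3.exists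
  exact strip_not_integrableOn_inv_sq hη hx

/-- A nonempty finite family carrying a total preorder has a greatest element (induction on the
family: compare the new element with the greatest of the rest). [folklore] -/
theorem strip_exists_max {ι : Type*} (r : ι → ι → Prop) (htrans : ∀ i j l, r i j → r j l → r i l)
    (s : Finset ι) (hs : s.Nonempty) (htot : ∀ i ∈ s, ∀ j ∈ s, r i j ∨ r j i) :
    ∃ m ∈ s, ∀ i ∈ s, r i m := by
  classical
  induction s using Finset.induction_on with
  | empty => exact absurd hs Finset.not_nonempty_empty
  | insert a s ha ih =>
    rcases s.eq_empty_or_nonempty with rfl | hne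
    · refine ⟨a, Finset.mem_insert_self _ _, fun i hi => ?_⟩
      rw [Finset.mem_insert] at hi
      rcases hi with rfl | hi
      · exact (htot i (Finset.mem_insert_self _ _) i (Finset.mem_insert_self _ _)).elim id id
      · exact absurd hi (Finset.notMem_empty _)
    · obtain ⟨m, hm, hmax⟩ := ih hne
        (fun i hi j hj => htot i (Finset.mem_insert_of_mem hi) j (Finset.mem_insert_of_mem hj))
      rcases htot a (Finset.mem_insert_self _ _) m (Finset.mem_insert_of_mem hm) with ham | hma
      · refine ⟨m, Finset.mem_insert_of_mem hm, fun i hi => ?_⟩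
        rcases Finset.mem_insert.1 hi with rfl | hi
        exacts [ham, hmax i hi]
      · refine ⟨a, Finset.mem_insert_self _ _, fun i hi => ?_⟩
        rcases Finset.mem_insert.1 hi with rfl | hi
        · exact (htot i (Finset.mem_insert_self _ _) i (Finset.mem_insert_self _ _)).elim id id
        · exact htrans _ _ _ (hmax i hi) hma

/-- Predicate form of `strip_exists_max`: among the finitely many "good" indices of a finite type,
pairwise comparable for a transitive relation, one is greatest. [folklore] -/
theorem strip_exists_greatest {ι : Type*} [Fintype ι] (good : ι → Prop) (r : ι → ι → Prop)
    (htrans : ∀ i j l, r i j → r j l → r i l) (htot : ∀ i j, good i → good j → r i j ∨ r j i)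
    (hne : ∃ i, good i) : ∃ m, good m ∧ ∀ i, good i → r i m := by
  classical
  obtain ⟨i₀, hi₀⟩ := hne
  obtain ⟨m, hm, hmax⟩ := strip_exists_max r htrans (Finset.univ.filter good)
    ⟨i₀, by simp [hi₀]⟩ (fun i hi j hj => htot i j (by simpa using hi) (by simpa using hj))
  exact ⟨m, by simpa using hm, fun i hi => hmax i (by simp [hi])⟩

/-- Near a point of an open set of reals at which a continuous function is positive there is a
whole open interval inside the set on which the function stays above a positive square. [folklore] -/
theorem strip_exists_interval {J : Set ℝ} (hJo : IsOpen J) {x₀ : ℝ} (hx₀ : x₀ ∈ J) {g : ℝ → ℝ}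
    (hg : Continuous g) (hgx : 0 < g x₀) :
    ∃ u v η : ℝ, u < v ∧ 0 < η ∧ ∀ x ∈ Ioo u v, x ∈ J ∧ η ^ 2 < g x := by
  have h1 : ∀ᶠ x in nhds x₀, g x₀ / 2 < g x :=
    hg.continuousAt.eventually (eventually_gt_nhds (half_lt_self hgx))
  obtain ⟨δ, hδ, hball⟩ := Metric.eventually_nhds_iff.1 ((hJo.eventually_mem hx₀).and h1)
  refine ⟨x₀ - δ, x₀ + δ, min 1 (g x₀ / 2), by linarith, lt_min one_pos (half_pos hgx),
    fun x hx => ?_⟩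
  have hx' : dist x x₀ < δ := by
    rw [Real.dist_eq, abs_sub_lt_iff]
    constructor <;> linarith [hx.1, hx.2]
  obtain ⟨hxJ, hgx'⟩ := hball hx'
  refine ⟨hxJ, ?_⟩
  have hm1 : min 1 (g x₀ / 2) ≤ 1 := min_le_left _ _
  have hm2 : min 1 (g x₀ / 2) ≤ g x₀ / 2 := min_le_right _ _
  have hm0 : 0 < min 1 (g x₀ / 2) := lt_min one_pos (half_pos hgx)
  nlinarith

/-- A downward parabola `c − (x − a)²` positive on a bounded open interval `(u, v)`, `u < v`, is
nonnegative at its end points (closedness of `{(x − a)² ≤ c}`). [folklore] -/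
theorem strip_endpoints {u v a c : ℝ} (huv : u < v) (h : ∀ x ∈ Ioo u v, 0 < c - (x - a) ^ 2) :
    (u - a) ^ 2 ≤ c ∧ (v - a) ^ 2 ≤ c := by
  have hcl : IsClosed {x : ℝ | (x - a) ^ 2 ≤ c} := isClosed_le (by fun_prop) continuous_const
  have hsub : Ioo u v ⊆ {x : ℝ | (x - a) ^ 2 ≤ c} := fun x hx => by
    have := h x hx
    simp only [mem_setOf_eq]
    linarith
  have hcs := hcl.closure_subset_iff.2 hsub
  rw [closure_Ioo huv.ne] at hcs
  exact ⟨hcs (left_mem_Icc.2 huv.le), hcs (right_mem_Icc.2 huv.le)⟩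

/-- A downward parabola `c − (x − a)²` is not positive on a whole half-line. [folklore] -/
theorem strip_not_pos_on_Ioi {u a c : ℝ} (h : ∀ x ∈ Ioi u, 0 < c - (x - a) ^ 2) : False := by
  set x := max u a + |c| + 1 with hx
  have hxJ : x ∈ Ioi u := by
    show u < x
    have := le_max_left u a
    have := abs_nonneg c
    linarith
  have h0 := h x hxJ
  have h1 : |c| + 1 ≤ x - a := by
    have := le_max_right u a
    linarith
  have h2 : (|c| + 1) ^ 2 ≤ (x - a) ^ 2 := pow_le_pow_left₀ (by positivity) h1 2
  nlinarith [abs_nonneg c, le_abs_self c, sq_nonneg |c|]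

/-- A downward parabola `c − (x − a)²` is not positive on a whole left half-line. [folklore] -/
theorem strip_not_pos_on_Iio {v a c : ℝ} (h : ∀ x ∈ Iio v, 0 < c - (x - a) ^ 2) : False := by
  set x := min v a - |c| - 1 with hx
  have hxJ : x ∈ Iio v := by
    show x < v
    have := min_le_left v a
    have := abs_nonneg c
    linarith
  have h0 := h x hxJ
  have h1 : |c| + 1 ≤ a - x := by
    have := min_le_right v a
    linarith
  have h2 : (|c| + 1) ^ 2 ≤ (a - x) ^ 2 := pow_le_pow_left₀ (by positivity) h1 2
  nlinarith [abs_nonneg c, le_abs_self c, sq_nonneg |c|]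

/-- STUB `stub_stripStructure`: structure of a finite-area rung-1 polygon over a strip free of
breakpoints. `P = {t > 0} ∩ ⋂ᵢ {0 < εᵢ gᵢ}` with `gᵢ` a vertical line `aᵢ x − cᵢ` or a semicircle
`(x − aᵢ)² + t² − cᵢ`; on an open `x`-interval on which the signs of the affine constraints, the
signs of the `cᵢ − (x − aᵢ)²` and their pairwise order are constant, `P` is (over that interval)
empty, or the region above ONE semicircle, or the region between TWO semicircles; unbounded such
intervals carry nothing. Finite area excludes floors `{0 < t < h(x)}` (`∫₀ t⁻² dt = ∞`).
[cite: KontsevichZagier2001, §1.2 rule (1)] -/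
theorem stub_stripStructure :
    ∀ (k : ℕ) (flat : Fin k → Bool) (a c ε : Fin k → ℝ) (P : Set (Fin 2 → ℝ)),
      (∀ i, ε i = 1 ∨ ε i = -1) →
      P = {p | 0 < p 1 ∧ ∀ i, 0 < ε i * (if flat i then a i * p 0 - c i else (p 0 - a i) ^ 2 + p 1 ^ 2 - c i)} →
      IntegrableOn (fun p : Fin 2 → ℝ => 1 / p 1 ^ 2) P →
    ∀ (J : Set ℝ), (∃ u v : ℝ, J = Ioo u v ∨ J = Ioi u ∨ J = Iio v) →
      (∀ i, flat i = true → (∀ x ∈ J, 0 < ε i * (a i * x - c i)) ∨ (∀ x ∈ J, ε i * (a i * x - c i) ≤ 0)) →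
      (∀ i, flat i = false → (∀ x ∈ J, 0 < c i - (x - a i) ^ 2) ∨ (∀ x ∈ J, c i - (x - a i) ^ 2 ≤ 0)) →
      (∀ i j, flat i = false → flat j = false →
        (∀ x ∈ J, c i - (x - a i) ^ 2 ≤ c j - (x - a j) ^ 2) ∨ (∀ x ∈ J, c j - (x - a j) ^ 2 ≤ c i - (x - a i) ^ 2)) →
      P ∩ {p | p 0 ∈ J} = ∅ ∨
      (∃ (u v : ℝ) (i : Fin k), J = Ioo u v ∧ flat i = false ∧ ε i = 1 ∧ (u - a i) ^ 2 ≤ c i ∧ (v - a i) ^ 2 ≤ c i ∧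
        P ∩ {p | p 0 ∈ J} = {p | u < p 0 ∧ p 0 < v ∧ 0 < p 1 ∧ c i < (p 0 - a i) ^ 2 + p 1 ^ 2}) ∨
      (∃ (u v : ℝ) (i j : Fin k), J = Ioo u v ∧ flat i = false ∧ flat j = false ∧ ε i = 1 ∧ ε j = -1 ∧
        (u - a i) ^ 2 ≤ c i ∧ (v - a i) ^ 2 ≤ c i ∧ (u - a j) ^ 2 ≤ c j ∧ (v - a j) ^ 2 ≤ c j ∧
        (∀ x ∈ Ioo u v, c i - (x - a i) ^ 2 ≤ c j - (x - a j) ^ 2) ∧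
        P ∩ {p | p 0 ∈ J} = {p | u < p 0 ∧ p 0 < v ∧ 0 < p 1 ∧ c i < (p 0 - a i) ^ 2 + p 1 ^ 2 ∧
          (p 0 - a j) ^ 2 + p 1 ^ 2 < c j}) := by
  intro k flat a c ε P hε hP hint J hJ hflat hround hcomp
  classical
  -- the empty strip
  rcases J.eq_empty_or_nonempty with hJe | ⟨x₀, hx₀⟩
  · left
    rw [hJe]
    simp
  -- `J` is open
  have hJo : IsOpen J := by
    obtain ⟨u, v, h | h | h⟩ := hJ <;> rw [h]
    exacts [isOpen_Ioo, isOpen_Ioi, isOpen_Iio]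
  -- an affine constraint violated throughout `J` empties the strip
  by_cases hfv : ∃ i, flat i = true ∧ ∀ x ∈ J, ε i * (a i * x - c i) ≤ 0
  · obtain ⟨i, hi, hviol⟩ := hfv
    left
    rw [hP, Set.eq_empty_iff_forall_notMem]
    rintro p ⟨⟨-, hp⟩, hpJ⟩
    have h1 := hp i
    rw [if_pos hi] at h1
    exact absurd (hviol (p 0) hpJ) (not_le.2 h1)
  have hfs : ∀ i, flat i = true → ∀ x ∈ J, 0 < ε i * (a i * x - c i) := fun i hi =>
    (hflat i hi).resolve_right fun h => hfv ⟨i, hi, h⟩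
  -- membership in `P` over the strip, in terms of the round constraints only
  have hmem : ∀ p : Fin 2 → ℝ, p 0 ∈ J → (p ∈ P ↔ 0 < p 1 ∧
      (∀ i, flat i = false → ε i = 1 → c i - (p 0 - a i) ^ 2 < p 1 ^ 2) ∧
      (∀ i, flat i = false → ε i = -1 → p 1 ^ 2 < c i - (p 0 - a i) ^ 2)) := by
    intro p hpJ
    rw [hP, mem_setOf_eq]
    constructor
    · rintro ⟨ht, hall⟩
      refine ⟨ht, fun i hi he => ?_, fun i hi he => ?_⟩
      · have h1 := hall i
        simp only [hi, Bool.false_eq_true, ↓reduceIte, he] at h1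
        linarith
      · have h1 := hall i
        simp only [hi, Bool.false_eq_true, ↓reduceIte, he] at h1
        linarith
    · rintro ⟨ht, hout, hin⟩
      refine ⟨ht, fun i => ?_⟩
      cases hfi : flat i
      · simp only [Bool.false_eq_true, ↓reduceIte]
        rcases hε i with he | he
        · have := hout i hfi he
          rw [he]
          linarith
        · have := hin i hfi he
          rw [he]
          linarith
      · simp only [↓reduceIte]
        exact hfs i hfi (p 0) hpJ
  -- is some "outside" circle active somewhere over `J`?
  by_cases hact : ∃ i, flat i = false ∧ ε i = 1 ∧ ∃ x ∈ J, 0 < c i - (x - a i) ^ 2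
  swap
  · -- no: all outside-constraints are vacuous over `J`
    push Not at hact
    by_cases hIn : ∃ j, flat j = false ∧ ε j = -1
    · -- the pointwise-smallest inside circle
      obtain ⟨j, ⟨hjf, hjε⟩, hjmin⟩ := strip_exists_greatest (fun j => flat j = false ∧ ε j = -1)
        (fun i j => ∀ x ∈ J, c j - (x - a j) ^ 2 ≤ c i - (x - a i) ^ 2)
        (fun i j l hij hjl x hx => (hjl x hx).trans (hij x hx))
        (fun i j hi hj => (hcomp i j hi.1 hj.1).symm) hIn
      rcases hround j hjf with hpos | hnonpos
      · -- a floor: infinite area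
        exfalso
        obtain ⟨u', v', η, huv', hη, hbox⟩ := strip_exists_interval hJo hx₀
          (g := fun x => c j - (x - a j) ^ 2) (by fun_prop) (hpos x₀ hx₀)
        refine strip_not_integrableOn_of_box huv' hη (fun p hp => ?_) hint
        obtain ⟨h1, h2, h3, h4⟩ := hp
        obtain ⟨hxJ, hgx⟩ : p 0 ∈ J ∧ η ^ 2 < c j - (p 0 - a j) ^ 2 := hbox (p 0) ⟨h1, h2⟩
        rw [hmem p hxJ]
        refine ⟨h3, fun i hi he => ?_, fun i hi he => ?_⟩
        · have := hact i hi he (p 0) hxJ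
          nlinarith
        · have hle := hjmin i ⟨hi, he⟩ (p 0) hxJ
          have : p 1 ^ 2 < η ^ 2 := sq_lt_sq' (by linarith) h4
          linarith
      · -- below a nonpositive ceiling: empty
        left
        rw [Set.eq_empty_iff_forall_notMem]
        rintro p ⟨hpP, hpJ⟩
        obtain ⟨-, -, hin⟩ := (hmem p hpJ).1 hpP
        have h1 := hin j hjf hjε
        have h2 := hnonpos (p 0) hpJ
        nlinarith [sq_nonneg (p 1)]
    · -- no constraint at all over `J`: full fibres, infinite area
      push Not at hIn
      exfalso
      obtain ⟨u', v', η, huv', hη, hbox⟩ := strip_exists_interval hJo hx₀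
        (g := fun _ => (1 : ℝ)) continuous_const one_pos
      refine strip_not_integrableOn_of_box huv' hη (fun p hp => ?_) hint
      obtain ⟨h1, h2, h3, -⟩ := hp
      obtain ⟨hxJ, -⟩ := hbox (p 0) ⟨h1, h2⟩
      rw [hmem p hxJ]
      refine ⟨h3, fun i hi he => ?_, fun i hi he => absurd he (hIn i hi)⟩
      have := hact i hi he (p 0) hxJ
      nlinarith
  · -- yes: take the pointwise-largest outside circle `i`
    obtain ⟨i₀, hi₀f, hi₀ε, x₁, hx₁, hpos₁⟩ := hact
    obtain ⟨i, ⟨hif, hiε⟩, himax⟩ := strip_exists_greatest (fun i => flat i = false ∧ ε i = 1)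
      (fun i j => ∀ x ∈ J, c i - (x - a i) ^ 2 ≤ c j - (x - a j) ^ 2)
      (fun i j l hij hjl x hx => (hij x hx).trans (hjl x hx))
      (fun i j hi hj => hcomp i j hi.1 hj.1) ⟨i₀, hi₀f, hi₀ε⟩
    -- it is positive throughout `J`
    have hipos : ∀ x ∈ J, 0 < c i - (x - a i) ^ 2 := by
      refine (hround i hif).resolve_right fun h => ?_
      have h1 := himax i₀ ⟨hi₀f, hi₀ε⟩ x₁ hx₁
      have h2 := h x₁ hx₁
      linarith
    -- hence `J` is a bounded interval `Ioo u v`, `u < v`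
    obtain ⟨u, v, rfl⟩ : ∃ u v, J = Ioo u v := by
      obtain ⟨u, v, h | h | h⟩ := hJ
      · exact ⟨u, v, h⟩
      · subst h
        exact (strip_not_pos_on_Ioi hipos).elim
      · subst h
        exact (strip_not_pos_on_Iio hipos).elim
    have huv : u < v := hx₀.1.trans hx₀.2
    obtain ⟨hiu, hiv⟩ := strip_endpoints huv hipos
    by_cases hIn : ∃ j, flat j = false ∧ ε j = -1
    · -- the pointwise-smallest inside circle `j`
      obtain ⟨j, ⟨hjf, hjε⟩, hjmin⟩ := strip_exists_greatest (fun j => flat j = false ∧ ε j = -1)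
        (fun i j => ∀ x ∈ Ioo u v, c j - (x - a j) ^ 2 ≤ c i - (x - a i) ^ 2)
        (fun i j l hij hjl x hx => (hjl x hx).trans (hij x hx))
        (fun i j hi hj => (hcomp i j hi.1 hj.1).symm) hIn
      rcases hcomp i j hif hjf with hij | hji
      · -- between two semicircles
        have hjpos : ∀ x ∈ Ioo u v, 0 < c j - (x - a j) ^ 2 := fun x hx =>
          (hipos x hx).trans_le (hij x hx)
        obtain ⟨hju, hjv⟩ := strip_endpoints huv hjpos
        right; right
        refine ⟨u, v, i, j, rfl, hif, hjf, hiε, hjε, hiu, hiv, hju, hjv, hij, ?_⟩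
        ext p
        constructor
        · rintro ⟨hpP, hpJ⟩
          obtain ⟨ht, hout, hin⟩ := (hmem p hpJ).1 hpP
          have h1 := hout i hif hiε
          have h2 := hin j hjf hjε
          exact ⟨hpJ.1, hpJ.2, ht, by linarith, by linarith⟩
        · rintro ⟨hpu, hpv, ht, h1, h2⟩
          have hpJ : p 0 ∈ Ioo u v := ⟨hpu, hpv⟩
          refine ⟨(hmem p hpJ).2 ⟨ht, fun l hl hle => ?_, fun l hl hle => ?_⟩, hpJ⟩
          · have := himax l ⟨hl, hle⟩ (p 0) hpJ
            linarith
          · have := hjmin l ⟨hl, hle⟩ (p 0) hpJ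
            linarith
      · -- the ceiling is below the floor: empty
        left
        rw [Set.eq_empty_iff_forall_notMem]
        rintro p ⟨hpP, hpJ⟩
        obtain ⟨-, hout, hin⟩ := (hmem p hpJ).1 hpP
        have h1 := hout i hif hiε
        have h2 := hin j hjf hjε
        have h3 := hji (p 0) hpJ
        linarith
    · -- above one semicircle
      push Not at hIn
      right; left
      refine ⟨u, v, i, rfl, hif, hiε, hiu, hiv, ?_⟩
      ext p
      constructor
      · rintro ⟨hpP, hpJ⟩
        obtain ⟨ht, hout, -⟩ := (hmem p hpJ).1 hpP
        have h1 := hout i hif hiε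
        exact ⟨hpJ.1, hpJ.2, ht, by linarith⟩
      · rintro ⟨hpu, hpv, ht, h1⟩
        have hpJ : p 0 ∈ Ioo u v := ⟨hpu, hpv⟩
        refine ⟨(hmem p hpJ).2 ⟨ht, fun l hl hle => ?_, fun l hl hle => absurd hle (hIn l hl)⟩, hpJ⟩
        have := himax l ⟨hl, hle⟩ (p 0) hpJ
        linarith

end Summit.KontsevichZagierPeriods.HyperbolicBloch.OffTetraSectorKernel

end
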